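import Summits.CriticalPhenomena.CardyFormulaZ2.Theses.CardyDualCurrent
import Summits.CriticalPhenomena.CardyFormulaZ2.Theorems.CardyDualCurrentMartingaleToSLE6Reduction
import Literature.Probability.Percolation.InterfaceScalingLimitDiscretised
import HarnessLib

/-!
# Skeleton r2 (lead reshape) for the crux `CardyDualCurrent.MartingaleToSLE6`
(item `stmt-CriticalPhenomena-11395`, route `route-CriticalPhenomena-CardyDualCurrent`, sub-problem
`CardyFormulaZ2`; line `registered` = birth skeleton `Lines/birth.lean`, reshaped by the lead
`prover-line-stmt-CriticalPhenomena-11395-0`, 2026-08-17)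

The crux is `TemplateCanonicalLimit → SLE6InterfaceLimit` (`Iff.rfl` with the route decls), and
`SLE6InterfaceLimit` is by `Iff.rfl` the Literature conjecture
`SLE6LimitZ2AllDiscretisations` (landed `sle6InterfaceLimit_iff_sle6LimitZ2AllDiscretisations`), i.e. block C = `SLESixAllFamilies` of the
sibling crux `CardyComplexCone.ParafermionToSLESixFamilies` (stmt-CriticalPhenomena-11389) with the
six `ZdDiscretisationFamily` fields bundled
(`slesixAllFamilies_iff_sle6LimitZ2AllDiscretisations`, landed p127450).

## Why the birth skeleton was reshaped (same composition idea, honest stubs)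

Birth = (T₁) tightness along families ∧ (KS) Loewner describability of subsequential limits ∧
(M) driving-martingale identification in Lévy's format ⇒ `isSLELaw_of_isLocalMartingale_driving_of_ae_tendsto`
⇒ Prokhorov. For bond percolation on `ℤ²` every one of these layers is ALREADY in the tree, in the
q = 1 files landed for stmt-11389 (route `CardyComplexCone`), down to exactly two named inputs:

* (T₁) is a THEOREM: `ZdDiscretisationFamily.isTightAlongMesh_bondInterfaceIn`
  (`Percolation/InterfaceTraversalBoundData4.lean`), landed as `stub_tightFamilies` (p90862) and
  consumed inside `slesixAllFamilies_of_slitMartingaleData`.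
* (KS) + the continuum half of (M) (Lévy + Rohde–Schramm at κ = 6, the σ = 1/3 Itô matching
  `W`, `W² − 6t`) are landed: `stub_sleSixOfLimitData` (p90439),
  `slitMartingaleData_of_percClockData : PercKSBoxData → PercParaClockData → SlitMartingaleData`
  (p90407 + clock form), `slesixAllFamilies_of_slitMartingaleData` (p127450); the describability
  and the driving convergence come out of `PercKSBoxData` by
  `ae_isLoewnerDescribable_and_tendstoInDistribution_drivingPath_varying` (KS17 Thm 1.5/Cor 1.7).
* What is NOT in the tree is (S1) `PercKSBoxData` — Kemppainen–Smirnov box data for the bond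
  interfaces of a discretisation FAMILY (Condition G2 from RSW; hypothesis-free; shared verbatim
  with stmt-11389's `stub_percKSBoxData`; reducible to `PercFaceBoxTight` by the landed
  `percKSBoxData_of_boxTight`, K1 proved p129499) — and (S2) the DISCRETE half of (M): the Doob
  martingale of the template variable tracks the spin-1/3 half-plane observable along the capacity
  clocks, `PercParaClockData` (its `X`, `c` are existential: any observable may witness it, in
  particular the crux's template). (S2) is the only stub consuming the antecedent
  `TemplateCanonicalLimit`, and it is where the crux is decided: by the landed exact bridge
  `percSlitExpectation_passageSum_eq_integral_pin` (p93017) the Doob martingale at step `n ≥ 1` is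
  the template observable of PINNED data `(E, O, C)`, which no admissible `DiscreteDobrushin` datum
  renders (`not_isZdAdmissible_rendering_of_pin`, p93367), while the antecedent speaks of `G (E δ)`
  for admissible data along families of JORDAN domains only.

Both stub signatures are built from EXISTING names only (no new vocabulary; the `Sig.stub_*` wrappers
merely name them for the skeleton audit): `PercFaceBoxTight`, `PercParaClockData`
(`Theorems/CardyComplexConeParafermionToSLESixFamilies{PercKSBoxFaceReduction,Reduction}.lean`),
`TemplateCanonicalLimit` (route decl). Composition `MartingaleToSLE6_of` is sorry-free and concludes
the crux BY NAME.

## r2 (2026-08-17, after wave 1 and the landing p147945)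

S1 sharpened from `PercKSBoxData` to its research-level half `PercFaceBoxTight` (the face-domain
kernel input K1 being the landed theorem `percFaceK1`, `percKSBoxData_of_boxTight`); the composition
is now the landed glue `martingaleToSLE6_of_percFaceBoxTight`
(`Theorems/CardyDualCurrentMartingaleToSLE6Reduction.lean`, p147945, which also records
`sle6InterfaceLimit_of_percKSBoxData_of_percParaClockData`: the consequent needs no antecedent once
`PercParaClockData` is known). Wave 1: S1 `stub-blocked: PercFaceBoxTight` (KS named fact
`exists_regularity_of_conditionG2` for simple curves; Condition G2 for the bond interface from RSW,
proved for no percolation interface in the tree; simple-curve transfer); S2: promote-stub (crux-sized,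
antecedent idle for every conditioning step `n ≥ 1`), `PROMOTE-stub_templateClockData.md`.

## r2, lead c1 (continuation `prover-line-stmt-CriticalPhenomena-11395-c1-0`, 2026-08-17): no reshape, two landings, verdict

Stubs unchanged (S1, S2). Wave 1 of lead c1: S1 `stub-blocked:
Literature.Probability.RandomPlanarGeometry.exists_regularity_of_conditionG2`, with the typed
CONDITIONAL REDUCTION landed (`Theorems/CardyDualCurrentMartingaleToSLE6StubPercFaceBoxTight.lean`,
p152755): `percFaceBoxTight_of_conditionG2_of_transfer` / `…_of_modification` — `PercFaceBoxTight`
from (i) the KS named fact, (ii) a measurable simple chordal modification `γm` of the polyline whose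
push-forward laws satisfy ONE `ConditionG2` in the oriented face domains (KS17 Prop. 4.3 at q = 1,
RSW), (iii) an eventual pathwise transfer of box membership `γm → bondInterfaceIn` with slack, (iv)
per-scale box tightness of the raw interface at each fixed admissible mesh (helpers `pairBox_mono`,
`exists_box_forall_of_eventually`, `measure_preimage_compl_le_map_add`); every hypothesis inlined,
each a fileable item of the shared SLE-transport debt. S2 (lead): the antecedent is idle and no line
can repair it — (a) compactness upgrade per-family ⇒ Carathéodory-uniform impossible (families have
the rigid vertex set `meshDomain D δ`; slit/pinned data belong to no family), (b) crossing/sandwich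
route impossible (`TemplateCanonicalLimit` gives interior values of one complex observable, locally
uniformly on the OPEN carrier: no boundary values, no monotone functional), (c) vacuity closed
(`DiscretisationFamilyExists_proof`, `templateCanonicalLimit_target_nonempty`). Certificates landed
(`Theorems/CardyDualCurrentMartingaleToSLE6Reduction.lean`, appended, p151418):
`martingaleToSLE6_of_sle6InterfaceLimit : SLE6InterfaceLimit → MartingaleToSLE6`,
`martingaleToSLE6_iff_sle6InterfaceLimit_of_templateCanonicalLimit`,
`martingaleToSLE6_iff_sle6InterfaceLimit_of_cruxes` — as filed, r5 is bracketed by r6 on both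
sides. Verdict of lead c1: `blocked-on: stmt-CriticalPhenomena-11283` (`SLE6InterfaceLimit`), see
`BLOCKED-ON-stmt-11283.md` in this crux directory; restatement advice unchanged (`RESTATEMENT.lean`).

## r2, lead c2 (continuation `prover-line-stmt-CriticalPhenomena-11395-c2-0`, 2026-08-17): no reshape, one landing, item-level verdict

Stubs unchanged (S1, S2); wave: none (S1's worker-sized content is the landed p152755 and S1 is
stub-blocked on the XL named fact `exists_regularity_of_conditionG2`; S2 is the verdict). Landed
(`Theorems/CardyDualCurrentMartingaleToSLE6ArcUniformity.lean`, p155238, registered helper stub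
`templateCanonicalLimit_uniformOverArcs`): the antecedent is AUTOMATICALLY UNIFORM over the
discrete arcs / marked edges of each fixed Jordan carrier (`exists_zdDiscretisationFamily_through`:
diagonal families; `uniformOverArcs_of_forall_family`: a per-family limit statement of the shape of
`TemplateCanonicalLimit`, for any observable and any limit, is uniform over all admissible data on
`D.carrier` with small mesh and Hausdorff-close arcs, one unit phase per datum). Hence the ONLY
uniformity the antecedent lacks is across CARRIERS — exactly what the Doob martingale at steps
`n ≥ 1` reads (same-mesh pinned expectations in `δ`-dependent random slit domains,
`percSlitExpectation_eq_integral_pin`); a per-carrier limit statement constrains no sequence with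
varying carriers, so S2 is not suppliable by the line's only lean and, as filed, r5 is r6
(p151418). Verdict of lead c2: `verdict: misstated` — see `VERDICT-MISSTATED.md` in this crux
directory (restatement options R1 = `RESTATEMENT.lean`, re-checked rc 0; R2 drop r5/r9; R3
Carathéodory form over pinned data).
-/

namespace Summit.CriticalPhenomena.CardyFormulaZ2.Cruxes.MartingaleToSLE6.Birth

open Summit.CriticalPhenomena.CardyFormulaZ2.Cruxes.ParafermionToSLESixFamilies.CaratheodoryNetSlitUniformity
  (PercKSBoxData PercFaceBoxTight PercParaClockData)
open Summit.CriticalPhenomena.CardyFormulaZ2.Theorems (martingaleToSLE6_of_percFaceBoxTight)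
open Summit.CriticalPhenomena.CardyFormulaZ2.Theses.CardyDualCurrent
  (TemplateCanonicalLimit SLE6InterfaceLimit MartingaleToSLE6)

/-! ### Stub signatures (named, so that the composition's hypotheses are the stubs BY NAME) -/

/-- Signature of `stub_percFaceBoxTight` (S1): verbatim the sibling crux's research-level input
`PercFaceBoxTight` (`Theorems/CardyComplexConeParafermionToSLESixFamiliesPercKSBoxFaceReduction.lean`):
Kemppainen–Smirnov box tightness of the raw medial exploration polyline of every discretisation
family, read through the chordal uniformizers of the oriented face domains. -/
def Sig.stub_percFaceBoxTight : Prop :=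
  PercFaceBoxTight

/-- Signature of `stub_templateClockData` (S2): the crux's antecedent `TemplateCanonicalLimit` gives
the clock-form slit-observable martingale approximation `PercParaClockData` (sibling crux's named
input, whose observable `X` and normalisation `c` are existential). -/
def Sig.stub_templateClockData : Prop :=
  TemplateCanonicalLimit → PercParaClockData

/-! ### The stubs -/

/-- stub S1 — Kemppainen–Smirnov box tightness of the bond interfaces of every discretisation
family of every Dobrushin domain in the oriented face domains (KS17 Prop 3.2 / Thms 3.9–3.10 from
Condition G2 = RSW on `ℤ²` uniformly over the discrete domains). Hypothesis-free; shared verbatim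
with stmt-11389 (`PercFaceBoxTight`). Wave 1: stub-blocked — missing (i) the KS named fact
`exists_regularity_of_conditionG2` (simple curves), (ii) Condition G2 for (a simple modification of)
`bondInterfaceIn` from `rsw_half_holds` + domain Markov, (iii) the simple-curve transfer of KS-box
membership back to the raw self-touching polyline. Size L–XL. Lead c1, wave 1: stub-blocked on (i);
typed conditional reduction LANDED (p152755): `percFaceBoxTight_of_conditionG2_of_modification hKS γm
hmeas hsupp hG2 htr hfin : PercFaceBoxTight` (this namespace,
`Theorems/CardyDualCurrentMartingaleToSLE6StubPercFaceBoxTight.lean`) — the stub is exactly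
(i) + (ii) `hsupp`/`hG2` for a modification map `γm` + (iii) `htr` + (iv) per-scale tightness `hfin`. -/
theorem stub_percFaceBoxTight : Sig.stub_percFaceBoxTight := by
  sorry

/-- stub S2 — the template clock data (the discrete half of the martingale identification, the
ONLY stub consuming the antecedent): under `TemplateCanonicalLimit`, for every family, chordal map,
admissible meshes and approximating uniformizers with KS boxes, the Doob martingale
`n ↦ c · E[X | 𝒢_n]` of the (normalised) template variable `X` at a bulk edge tracks
`paraObservableProcess` along an adapted capacity clock (domain Markov property — landed
`martingale_percSlitExpectation`; pinned bridge — landed; capacity clocks / locality — landed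
`…PercClockBridge`, `…PercDrivingLocality`; and the identification of the PINNED template
observable Carathéodory-uniformly over the slit data — NOT supplied by the antecedent, which is
silent on pinned data: the research content). Size XL. -/
theorem stub_templateClockData : Sig.stub_templateClockData := by
  sorry

/-! ### The composition (sorry-free): the two stubs give the crux BY NAME -/

/-- **`MartingaleToSLE6` from the two stubs**, by the landed glue
`martingaleToSLE6_of_percFaceBoxTight` (p147945): K1 (`percFaceK1`) + S1 give `PercKSBoxData`,
S2 gives the clock data under the antecedent, `slitMartingaleData_of_percClockData` and
`slesixAllFamilies_of_slitMartingaleData` (tightness of families + κ = 6 identification of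
subsequential limits + Prokhorov/uniqueness) give block C = the consequent. -/
theorem MartingaleToSLE6_of :
    Sig.stub_percFaceBoxTight → Sig.stub_templateClockData →
      Summit.CriticalPhenomena.CardyFormulaZ2.Theses.CardyDualCurrent.MartingaleToSLE6 :=
  fun hT hCl => martingaleToSLE6_of_percFaceBoxTight hT hCl

/-- The line closes the crux MODULO ITS STUBS (closure contains `sorryAx` through the two open
`stub_*` only): the hypotheses of `MartingaleToSLE6_of` are literally the stub statements. -/
theorem MartingaleToSLE6_of_stubs :
    Summit.CriticalPhenomena.CardyFormulaZ2.Theses.CardyDualCurrent.MartingaleToSLE6 :=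
  MartingaleToSLE6_of stub_percFaceBoxTight stub_templateClockData

end Summit.CriticalPhenomena.CardyFormulaZ2.Cruxes.MartingaleToSLE6.Birth
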